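import Summits.BirchSwinnertonDyer.BirchSwinnertonDyer.Theorems.ThetaPartnerAtTwoSignedKatoUpToAtTwoCuspFactorCharacter
import Summits.BirchSwinnertonDyer.BirchSwinnertonDyer.Theorems.ThetaPartnerAtTwoSignedControlAtTwoPlusLayerTwo
import Literature.NumberTheory.EllipticCurves.PAdicPowerSeriesCharacterEvaluationProofs
import HarnessLib

/-!
# Route `ThetaPartnerAtTwo` (TP2), crux K3 `SignedKatoDivisibilityUpToAtTwo` (stmt-BirchSwinnertonDyer-20308 / K3P′ 25631), line
# `colemanrat` v13, assembly glue EVAL-χ — the four-term CUSP ELEMENT of brick B1 EVALUATED AT CHARACTER POINTS: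
# `(1+T)^{ℓ(u)}` at `T = ρ(γ) − 1` is `ρ(u)` for every EVEN `2`-power-order `ρ` and every `2`-adic unit `u`

Width seat `bsd-wall-tp2-p2x-w3` g7 (cell `bsd-wall`); memo `Cruxes/SignedKatoDivisibilityUpToAtTwo/G7-ASSEMBLY-v1.md` §0 step 5
(«`U_c ∈ Λ := (1+T)^{ℓ(⟨c⟩)}` … characterised by `U_c(χ) = χ(c)` (NO bar) for every even 2-power-order `χ`») and the evaluation
clause of brick B1 («`μ̃(χ) = D·R⁻(χ; c, d, a, 2^e, d′)`»). HONEST FRAMING: theorems only (no definition, no named fact, no instance,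
no `sorry`); closes no item; K3 / K3P′ are NOT settled and BSD is NOT proved by any of this.

## What

Brick B1 (`CuspEval.exists_cuspElement_not_mem`, w2 g6; `MultAvoid.exists_fourTerm_not_mem`, w5 g0) produces, for every height-one prime
`𝔭 ∌ 2` of `Λ = ℤ₂⟦T⟧`, admissible `c, d` (odd naturals, `2`-adic units `uc, ud`) and integers `a₁ … a₄` with
`μ̃ := C a₁ − C a₂·(1+T)^{η ℓ(uc)} − C a₃·(1+T)^{η ℓ(ud)} + C a₄·(1+T)^{η ℓ(uc)}(1+T)^{η ℓ(ud)} ∉ 𝔭` (`ℓ = CyclotomicZp.ell 2`, the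
normalised `2`-adic logarithm `5^{2ℓ(u)} = u²`; `(1+T)^x = PowerSeries.binomialSeries ℤ_[2] x`). The socket CORE_χ^prim reads elements
of `Λ` through their values `F(ρ) := ∑' k ι(coeff k F)·(ρ(γ) − 1)^k` at even `2`-power-order characters `ρ` modulo `2^m` (`γ = 5`).
This file supplies the value of `μ̃` (at `η = 1`):

* §1 `cycPow_ell_eq_or` (`5^{ℓ(u)} = ±u`: the projection `ℤ₂ˣ = {±1} × (1 + 4ℤ₂) → 1 + 4ℤ₂`).
* §2 `hasSum_coeff_binomialSeries_ell_character`: **`(1+T)^{ℓ(u)}` at `T = ρ(γ) − 1` is `ρ(u mod 2^m)`** for `ρ` even of `2`-power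
  order (tree `hasSum_cpCoeff_binomialSeries_character`: the value is `ρ(5^{ℓ(u)}) = ρ(±u)`, and `ρ(−1) = 1`); natural-number form
  `…_natCast` (`ρ(c)` for `uc = c`), and the `tsum` forms.
* §3 `tsum_coeff_cuspElement_character`: **`μ̃(ρ) = ι a₁ − ι a₂·ρ(c) − ι a₃·ρ(d) + ι a₄·ρ(c)ρ(d)`** (w2 g6's `tsum_coeff_cuspElement` at
  `z = ρ(γ) − 1`), and the integer-coefficient form `tsum_coeff_cuspElement_character_intCast` matching the element of
  `CuspEval.exists_cuspElement_not_mem` at `η = 1` literally.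

References: L. Washington, *Introduction to cyclotomic fields* (1997) §7.2 [Washington1997]; S. Lang, *Cyclotomic fields I and II*
(1990) Ch. 4 §1 [LangCyclotomic1990]; K. Kato, Astérisque 295 (2004) §13.12 [Kato2004Asterisque].
-/

set_option autoImplicit false
-- the Theorems namespace of this sub repeats the summit name by design (D-0017 nested layout)
set_option linter.dupNamespace false

noncomputable section

open scoped BigOperators

open Literature.NumberTheory.EllipticCurves Literature.NumberTheory.EllipticCurves.CyclotomicZp
  Literature.NumberTheory.EllipticCurves.PadicOneUnits

namespace Summit.BirchSwinnertonDyer.BirchSwinnertonDyer.Theorems.SignedKatoOffTwo.CuspEval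

/-! ## §1 The projection `5^{ℓ(u)} = ±u` -/

/-- **`5^{ℓ(u)} = ±u`**: the unit `γ^{ℓ(u)} = cycPow 2 (ell 2 u)` is the projection of `u` to `1 + 4ℤ₂` along `ℤ₂ˣ = {±1} × (1 + 4ℤ₂)`,
i.e. `u` if `u ≡ 1 (mod 4)` and `−u` if `u ≡ −1 (mod 4)` (w2 g6's `cycPow_ell_eq_of_norm_sub_one_le` on `u` resp. `−u`, and
`ℓ(−u) = ℓ(u)`, tree `SignedEC.PlusLayer.ell_neg`). [cite: Washington1997, §7.2] -/
theorem cycPow_ell_eq_or (u : ℤ_[2]ˣ) : cycPow 2 (ell 2 u) = (u : ℤ_[2]) ∨ cycPow 2 (ell 2 u) = -(u : ℤ_[2]) := by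
  have hdec : ∀ v v' : ZMod (2 ^ 2), v * v' = 1 → v = 1 ∨ v = -1 := by decide
  have hp : ((2 : ℕ) : ℤ_[2]) = (2 : ℤ_[2]) := by norm_num
  rcases hdec (PadicInt.toZModPow 2 (u : ℤ_[2])) (PadicInt.toZModPow 2 ((u⁻¹ : ℤ_[2]ˣ) : ℤ_[2]))
      (by rw [← map_mul, Units.mul_inv, map_one]) with h1 | h1
  · left
    refine cycPow_ell_eq_of_norm_sub_one_le u ?_
    have h := norm_sub_one_le_of_toZModPow_eq_one 2 h1
    rwa [hp] at h
  · right
    have h1' : PadicInt.toZModPow 2 ((-u : ℤ_[2]ˣ) : ℤ_[2]) = 1 := by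
      rw [Units.val_neg, map_neg, h1, neg_neg]
    have h := norm_sub_one_le_of_toZModPow_eq_one 2 h1'
    rw [hp] at h
    have h2 := cycPow_ell_eq_of_norm_sub_one_le (-u) h
    rwa [SignedEC.PlusLayer.ell_neg, Units.val_neg] at h2

/-! ## §2 `(1+T)^{ℓ(u)}` at an even `2`-power-order character point is `ρ(u)` -/

section Character

variable {m : ℕ} (ρ : DirichletCharacter ℂ_[2] (2 ^ m))

/-- **`U_u(ρ) = ρ(u)`.** For an EVEN Dirichlet character `ρ` modulo `2^m` with values in `ℂ₂` of `2`-power order and a `2`-adic unit `u`: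
`∑_k ι(coeff_k (1+T)^{ℓ(u)})·(ρ(γ) − 1)^k = ρ(u mod 2^m)`. Indeed the series converges to `ρ(γ^{ℓ(u)} mod 2^m)`
(tree `hasSum_cpCoeff_binomialSeries_character`), `γ^{ℓ(u)} = ±u` (§1) and `ρ(−1) = 1`. This is the «`U_c(χ) = χ(c)`, NO bar» line
of memo G7-ASSEMBLY-v1 §0.5. [cite: LangCyclotomic1990, Ch. 4 §1, Examples 1–2 (PDF p. 79)] [cite: Washington1997, §7.2] -/
theorem hasSum_coeff_binomialSeries_ell_character (hev : ρ.Even) (hord : ∃ j : ℕ, orderOf ρ = 2 ^ j) (u : ℤ_[2]ˣ) :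
    HasSum (fun k ↦ ((algebraMap ℚ_[2] ℂ_[2]).comp (algebraMap ℤ_[2] ℚ_[2]))
        (PowerSeries.coeff k (PowerSeries.binomialSeries ℤ_[2] (ell 2 u))) *
          (ρ (cyclotomicGenerator 2 : ZMod (2 ^ m)) - 1) ^ k)
      (ρ (PadicInt.toZModPow m (u : ℤ_[2]))) := by
  have h := hasSum_cpCoeff_binomialSeries_character (p := 2) ρ hord (ell 2 u)
  rcases cycPow_ell_eq_or u with hu | hu
  · rwa [hu] at h
  · have hneg : ρ (PadicInt.toZModPow m (-(u : ℤ_[2]))) = ρ (PadicInt.toZModPow m (u : ℤ_[2])) := by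
      rw [map_neg, ← neg_one_mul, map_mul]
      have h1 : ρ (-1) = 1 := hev
      rw [h1, one_mul]
    rwa [hu, hneg] at h

/-- `tsum` form of `hasSum_coeff_binomialSeries_ell_character`. [cite: LangCyclotomic1990, Ch. 4 §1, Examples 1–2 (PDF p. 79)] -/
theorem tsum_coeff_binomialSeries_ell_character (hev : ρ.Even) (hord : ∃ j : ℕ, orderOf ρ = 2 ^ j) (u : ℤ_[2]ˣ) :
    ∑' k, ((algebraMap ℚ_[2] ℂ_[2]).comp (algebraMap ℤ_[2] ℚ_[2]))
        (PowerSeries.coeff k (PowerSeries.binomialSeries ℤ_[2] (ell 2 u))) *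
          (ρ (cyclotomicGenerator 2 : ZMod (2 ^ m)) - 1) ^ k =
      ρ (PadicInt.toZModPow m (u : ℤ_[2])) :=
  (hasSum_coeff_binomialSeries_ell_character ρ hev hord u).tsum_eq

/-- **`U_c(ρ) = ρ(c)`** for an odd natural number `c` read as the `2`-adic unit `uc` (`(uc : ℤ₂) = c`): the value of `(1+T)^{ℓ(uc)}` at
`ρ(γ) − 1` is `ρ(c mod 2^m)`. [cite: LangCyclotomic1990, Ch. 4 §1, Examples 1–2 (PDF p. 79)] [cite: Washington1997, §7.2] -/
theorem tsum_coeff_binomialSeries_ell_character_natCast (hev : ρ.Even) (hord : ∃ j : ℕ, orderOf ρ = 2 ^ j)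
    {c : ℕ} (uc : ℤ_[2]ˣ) (huc : (uc : ℤ_[2]) = c) :
    ∑' k, ((algebraMap ℚ_[2] ℂ_[2]).comp (algebraMap ℤ_[2] ℚ_[2]))
        (PowerSeries.coeff k (PowerSeries.binomialSeries ℤ_[2] (ell 2 uc))) *
          (ρ (cyclotomicGenerator 2 : ZMod (2 ^ m)) - 1) ^ k =
      ρ (c : ZMod (2 ^ m)) := by
  rw [tsum_coeff_binomialSeries_ell_character ρ hev hord uc, huc, map_natCast]

/-- The character point lies in the open unit disc: `‖ρ(γ) − 1‖ < 1` for `ρ` of `2`-power order (tree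
`norm_apply_cyclotomicGenerator_sub_one_lt`, restated at `p = 2` for the `2 ^ m` spelling of the level). [folklore] -/
theorem norm_apply_cyclotomicGenerator_sub_one_lt_two (hord : ∃ j : ℕ, orderOf ρ = 2 ^ j) :
    ‖ρ (cyclotomicGenerator 2 : ZMod (2 ^ m)) - 1‖ < 1 :=
  norm_apply_cyclotomicGenerator_sub_one_lt (p := 2) ρ hord

end Character

/-! ## §3 The four-term cusp element at character points -/

section CuspElement

variable {m : ℕ} (ρ : DirichletCharacter ℂ_[2] (2 ^ m))

/-- **The cusp element at a character.** For `ρ` even of `2`-power order modulo `2^m`, `2`-adic units `uc, ud` and coefficients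
`a₁ … a₄ ∈ ℤ₂`: the value at `ρ(γ) − 1` of `C a₁ − C a₂·(1+T)^{ℓ(uc)} − C a₃·(1+T)^{ℓ(ud)} + C a₄·(1+T)^{ℓ(uc)}·(1+T)^{ℓ(ud)}` is
`ι a₁ − ι a₂·ρ(uc) − ι a₃·ρ(ud) + ι a₄·ρ(uc)·ρ(ud)` (w2 g6's `tsum_coeff_cuspElement` at `z = ρ(γ) − 1`, §2). This is the evaluation
clause «`μ̃(χ) = D·(c²d²[a]⁻ − cd²χ(c)[ac]⁻ − c²dχ(d)[ad′]⁻ + cdχ(cd)[acd′]⁻)`» of brick B1 once `a₁ … a₄` are the cleared minus symbols.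
[cite: Kato2004Asterisque, §13.12 (pp. 231–233)] [cite: LangCyclotomic1990, Ch. 4 §1, Examples 1–2 (PDF p. 79)] -/
theorem tsum_coeff_cuspElement_character (hev : ρ.Even) (hord : ∃ j : ℕ, orderOf ρ = 2 ^ j) (a₁ a₂ a₃ a₄ : ℤ_[2])
    (uc ud : ℤ_[2]ˣ) :
    ∑' k, ((algebraMap ℚ_[2] ℂ_[2]).comp (algebraMap ℤ_[2] ℚ_[2]))
        (PowerSeries.coeff k (PowerSeries.C a₁ - PowerSeries.C a₂ * PowerSeries.binomialSeries ℤ_[2] (ell 2 uc)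
          - PowerSeries.C a₃ * PowerSeries.binomialSeries ℤ_[2] (ell 2 ud)
          + PowerSeries.C a₄ * PowerSeries.binomialSeries ℤ_[2] (ell 2 uc) * PowerSeries.binomialSeries ℤ_[2] (ell 2 ud))) *
          (ρ (cyclotomicGenerator 2 : ZMod (2 ^ m)) - 1) ^ k =
      ((algebraMap ℚ_[2] ℂ_[2]).comp (algebraMap ℤ_[2] ℚ_[2])) a₁
        - ((algebraMap ℚ_[2] ℂ_[2]).comp (algebraMap ℤ_[2] ℚ_[2])) a₂ * ρ (PadicInt.toZModPow m (uc : ℤ_[2]))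
        - ((algebraMap ℚ_[2] ℂ_[2]).comp (algebraMap ℤ_[2] ℚ_[2])) a₃ * ρ (PadicInt.toZModPow m (ud : ℤ_[2]))
        + ((algebraMap ℚ_[2] ℂ_[2]).comp (algebraMap ℤ_[2] ℚ_[2])) a₄ * ρ (PadicInt.toZModPow m (uc : ℤ_[2])) *
            ρ (PadicInt.toZModPow m (ud : ℤ_[2])) := by
  rw [tsum_coeff_cuspElement (norm_apply_cyclotomicGenerator_sub_one_lt_two ρ hord),
    tsum_coeff_binomialSeries_ell_character ρ hev hord uc, tsum_coeff_binomialSeries_ell_character ρ hev hord ud]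

/-- **The cusp element of `CuspEval.exists_cuspElement_not_mem` (at `η = 1`) at a character.** With INTEGER coefficients
`A₁ … A₄` and odd naturals `c, d` carried by the units `uc, ud` (`(uc : ℤ₂) = c`, `(ud : ℤ₂) = d`): the value at `ρ(γ) − 1` of
`C A₁ − C A₂·(1+T)^{ℓ(uc)} − C A₃·(1+T)^{ℓ(ud)} + C A₄·(1+T)^{ℓ(uc)}(1+T)^{ℓ(ud)}` is `A₁ − A₂·ρ(c) − A₃·ρ(d) + A₄·ρ(c)·ρ(d)` in `ℂ₂`,
for every even `ρ` of `2`-power order modulo `2^m`. [cite: Kato2004Asterisque, §13.12 (pp. 231–233)]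
[cite: LangCyclotomic1990, Ch. 4 §1, Examples 1–2 (PDF p. 79)] -/
theorem tsum_coeff_cuspElement_character_intCast (hev : ρ.Even) (hord : ∃ j : ℕ, orderOf ρ = 2 ^ j) (A₁ A₂ A₃ A₄ : ℤ)
    {c d : ℕ} (uc ud : ℤ_[2]ˣ) (huc : (uc : ℤ_[2]) = c) (hud : (ud : ℤ_[2]) = d) :
    ∑' k, ((algebraMap ℚ_[2] ℂ_[2]).comp (algebraMap ℤ_[2] ℚ_[2]))
        (PowerSeries.coeff k (PowerSeries.C (A₁ : ℤ_[2]) - PowerSeries.C (A₂ : ℤ_[2]) * PowerSeries.binomialSeries ℤ_[2] (ell 2 uc)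
          - PowerSeries.C (A₃ : ℤ_[2]) * PowerSeries.binomialSeries ℤ_[2] (ell 2 ud)
          + PowerSeries.C (A₄ : ℤ_[2]) * PowerSeries.binomialSeries ℤ_[2] (ell 2 uc) *
              PowerSeries.binomialSeries ℤ_[2] (ell 2 ud))) *
          (ρ (cyclotomicGenerator 2 : ZMod (2 ^ m)) - 1) ^ k =
      (A₁ : ℂ_[2]) - (A₂ : ℂ_[2]) * ρ (c : ZMod (2 ^ m)) - (A₃ : ℂ_[2]) * ρ (d : ZMod (2 ^ m))
        + (A₄ : ℂ_[2]) * ρ (c : ZMod (2 ^ m)) * ρ (d : ZMod (2 ^ m)) := by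
  have hι : ∀ A : ℤ, ((algebraMap ℚ_[2] ℂ_[2]).comp (algebraMap ℤ_[2] ℚ_[2])) (A : ℤ_[2]) = (A : ℂ_[2]) :=
    fun A ↦ map_intCast _ A
  rw [tsum_coeff_cuspElement_character ρ hev hord, huc, hud, map_natCast (PadicInt.toZModPow m) c,
    map_natCast (PadicInt.toZModPow m) d, hι, hι, hι, hι]

/-- **`HasSum` form** of `tsum_coeff_cuspElement_character_intCast` (the series converges: all coefficients are `2`-adic integers and
`‖ρ(γ) − 1‖ < 1`). [cite: LangCyclotomic1990, Ch. 4 §1, Thm. 1.2 (PDF p. 79)] -/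
theorem hasSum_coeff_cuspElement_character_intCast (hev : ρ.Even) (hord : ∃ j : ℕ, orderOf ρ = 2 ^ j) (A₁ A₂ A₃ A₄ : ℤ)
    {c d : ℕ} (uc ud : ℤ_[2]ˣ) (huc : (uc : ℤ_[2]) = c) (hud : (ud : ℤ_[2]) = d) :
    HasSum (fun k ↦ ((algebraMap ℚ_[2] ℂ_[2]).comp (algebraMap ℤ_[2] ℚ_[2]))
        (PowerSeries.coeff k (PowerSeries.C (A₁ : ℤ_[2]) - PowerSeries.C (A₂ : ℤ_[2]) * PowerSeries.binomialSeries ℤ_[2] (ell 2 uc)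
          - PowerSeries.C (A₃ : ℤ_[2]) * PowerSeries.binomialSeries ℤ_[2] (ell 2 ud)
          + PowerSeries.C (A₄ : ℤ_[2]) * PowerSeries.binomialSeries ℤ_[2] (ell 2 uc) *
              PowerSeries.binomialSeries ℤ_[2] (ell 2 ud))) *
          (ρ (cyclotomicGenerator 2 : ZMod (2 ^ m)) - 1) ^ k)
      ((A₁ : ℂ_[2]) - (A₂ : ℂ_[2]) * ρ (c : ZMod (2 ^ m)) - (A₃ : ℂ_[2]) * ρ (d : ZMod (2 ^ m))
        + (A₄ : ℂ_[2]) * ρ (c : ZMod (2 ^ m)) * ρ (d : ZMod (2 ^ m))) := by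
  rw [← tsum_coeff_cuspElement_character_intCast ρ hev hord A₁ A₂ A₃ A₄ uc ud huc hud]
  exact (summable_map_coeff_mul_pow _ (norm_algebraMap_coeff_le_one _)
    (norm_apply_cyclotomicGenerator_sub_one_lt_two ρ hord)).hasSum

end CuspElement

end Summit.BirchSwinnertonDyer.BirchSwinnertonDyer.Theorems.SignedKatoOffTwo.CuspEval

end
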